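import Summits.ABC.ABC.Theses.TwistAmplification
import Literature.NumberTheory.DiophantineGeometry.AbcShapeReductionCount

-- Summit.ABC.ABC is the mandated summit-side namespace (single-conjunct summit); the lakefile sets the same option tree-wide.
set_option linter.dupNamespace false

/-!
# Depth-parametric emptiness of the deep region (crux stmt-ABC-2757 `MazurKaneLaw`, line `critical-kloosterman-powerful-moduli`)

Lead c4 (prover-line-stmt-ABC-2757-c4-0, 2026-08-16). In the tree's shape language (`AbcShapes`: `a = c₁ ∏ᵢ xᵢ^{i+1}`,
coordinate `0` linear, `1` the square level, `≥ 2` cube-full; a dyadic class `C₀` has data `(C₀; c₁,c₂,c₃; X,Y,Z)`,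
`Admissible l ε`; `P = ∏ᵢ XᵢYᵢZᵢ`, `P₀ = X₀Y₀Z₀`, `P₁ = X₁Y₁Z₁`, `R = C₀^{l-1+3ε}` the law,
`A = (c₁·shapeVal X)(c₂·shapeVal Y)(c₃·shapeVal Z) ≤ (2C₀)³`), the fallback skeleton
`Cruxes/MazurKaneLaw/Lines/critical_kloosterman_powerful_moduli.lean` cuts the crux into the OFF-WALL region
(`P ≤ 2R·P₀`, or `P ≤ 2R·P₁ ∧ P³ ≤ 64R³·A` — landed `stub_offWall`), the NEAR-WALL region (not off-wall, linear depth
`P/(R P₀) ≤ 2C₀^{1/4}` — the open lever) and the DEEP residual (depth `> 2C₀^{1/4}`), and proves the deep residual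
EMPTY for `l ≥ 15/8` (`not_deep`). This file generalises that emptiness lemma to an ARBITRARY depth exponent `τ`:

* `prod_pow_three_le`, `prod_cube_le` — the structure inequality `P³ ≤ A·P₀²·P₁` (`∏ xᵢ^{i+1} ≥ x₀x₁²(∏_{i≥2} xᵢ)³`);
* `prod_sq_le`, `prod_sq_le_three` — the second structure inequality `P² ≤ A·P₀`;
* `two_le_numShapes`, `admissible_swap` — coordinates `0, 1` exist for `ε < 1/2`; admissibility is symmetric in `a ↔ b`;
* `not_deep_of_depth` — for admissible data at `l ∈ [2 - τ/2, 2)`, not-off-wall forces `P ≤ 2R·C₀^τ·P₀`.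
  (`τ = 1/4` is the skeleton's `not_deep`, threshold `15/8`.) Used by `…KloostermanReach` to turn the lever at ANY
  depth `τ` into the Mazur–Kane law on `[2 - τ/2, 2)`.

All six lemmas are adapted from Cruxes/MazurKaneLaw/Lines/critical_kloosterman_powerful_moduli.lean (lead -2 / crux-plan),
where they are proved glue of a `sorry`-carrying skeleton and hence not importable.
-/

noncomputable section

open Finset
open Literature.NumberTheory.DiophantineGeometry
open Literature.NumberTheory.DiophantineGeometry.AbcShapes

namespace Summit.ABC.ABC.Theorems.MazurKaneLaw

/-! ## Glue and structure inequalities -/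

/-- For `0 < ε < 1/2` there are at least two shape levels (`⌊10/ε²⌋ ≥ 40`), so coordinates `0` and `1` exist. [folklore] -/
theorem two_le_numShapes {ε : ℝ} (hε : 0 < ε) (hε2 : ε < 1 / 2) : 2 ≤ numShapes ε := by
  -- adapted from Cruxes/MazurKaneLaw/Lines/critical_kloosterman_powerful_moduli.lean
  unfold numShapes
  apply Nat.le_floor
  rw [Nat.cast_ofNat, le_div_iff₀ (by positivity)]
  nlinarith

/-- Admissibility is symmetric in the first two terms. [folklore] -/
theorem admissible_swap {l ε : ℝ} {M : ℕ} {C₀ c₁ c₂ c₃ : ℕ} {X Y Z : Fin M → ℕ}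
    (hA : Admissible l ε C₀ c₁ c₂ c₃ X Y Z) : Admissible l ε C₀ c₂ c₁ c₃ Y X Z where
  one_le := hA.one_le
  pos₁ := hA.pos₂
  pos₂ := hA.pos₁
  pos₃ := hA.pos₃
  le₁ := hA.le₂
  le₂ := hA.le₁
  le₃ := hA.le₃
  X_pos := hA.Y_pos
  Y_pos := hA.X_pos
  Z_pos := hA.Z_pos
  prod_le := by
    have h := hA.prod_le
    calc (∏ i, ((Y i : ℝ) * X i * Z i)) = ∏ i, ((X i : ℝ) * Y i * Z i) :=
          Finset.prod_congr rfl fun i _ => by ring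
      _ ≤ _ := h
  valX_le := hA.valY_le
  valY_le := hA.valX_le
  valZ_le := hA.valZ_le
  le_valZ := hA.le_valZ

/-- One shape tuple: `(∏ᵢ xᵢ)³ ≤ (∏ᵢ xᵢ^{i+1}) · x₀² · x₁`, because every exponent `i + 1` with `i ≥ 2` is `≥ 3`. [folklore] -/
theorem prod_pow_three_le {M : ℕ} (X : Fin M → ℕ) (hX : ∀ i, 0 < X i) (i₀ i₁ : Fin M)
    (h0 : (i₀ : ℕ) = 0) (h1 : (i₁ : ℕ) = 1) :
    (∏ i, X i) ^ 3 ≤ shapeVal X * (X i₀ ^ 2 * X i₁) := by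
  obtain ⟨m, rfl⟩ : ∃ m, M = m + 2 := ⟨M - 2, by have := i₁.isLt; omega⟩
  have hi0 : i₀ = 0 := Fin.ext h0
  have hi1 : i₁ = 1 := Fin.ext (by simp [h1])
  rw [hi0, hi1, shapeVal, Fin.prod_univ_succ, Fin.prod_univ_succ (n := m),
    Fin.prod_univ_succ (f := fun i : Fin (m + 2) => X i ^ ((i : ℕ) + 1)),
    Fin.prod_univ_succ (f := fun i : Fin (m + 1) => X i.succ ^ ((i.succ : ℕ) + 1))]
  simp only [Fin.val_zero, Fin.val_succ, zero_add, pow_one, Fin.succ_zero_eq_one]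
  set T : ℕ := ∏ i : Fin m, X i.succ.succ with hTdef
  set T' : ℕ := ∏ i : Fin m, X i.succ.succ ^ ((i : ℕ) + 1 + 1 + 1) with hT'def
  have hT : T ^ 3 ≤ T' := by
    rw [hTdef, hT'def, ← prod_pow]
    refine prod_le_prod (fun i _ => Nat.zero_le _) fun i _ => ?_
    exact Nat.pow_le_pow_right (hX _) (by omega)
  calc (X 0 * (X 1 * T)) ^ 3 = X 0 * X 1 ^ (1 + 1) * (X 0 ^ 2 * X 1) * T ^ 3 := by ring
    _ ≤ X 0 * X 1 ^ (1 + 1) * (X 0 ^ 2 * X 1) * T' := Nat.mul_le_mul_left _ hT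
    _ = X 0 * (X 1 ^ (1 + 1) * T') * (X 0 ^ 2 * X 1) := by ring

/-- THE STRUCTURE INEQUALITY `P³ ≤ Θ³(2C₀)³·P₀²·P₁`, in the form
`(∏ XᵢYᵢZᵢ)³ ≤ (c₁·shapeVal X)(c₂·shapeVal Y)(c₃·shapeVal Z) · (X₀Y₀Z₀)² (X₁Y₁Z₁)`. [folklore] -/
theorem prod_cube_le {M : ℕ} {c₁ c₂ c₃ : ℕ} (hc₁ : 0 < c₁) (hc₂ : 0 < c₂) (hc₃ : 0 < c₃)
    (X Y Z : Fin M → ℕ) (hX : ∀ i, 0 < X i) (hY : ∀ i, 0 < Y i) (hZ : ∀ i, 0 < Z i)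
    (i₀ i₁ : Fin M) (h0 : (i₀ : ℕ) = 0) (h1 : (i₁ : ℕ) = 1) :
    (∏ i, ((X i : ℝ) * Y i * Z i)) ^ 3 ≤
      ((c₁ * shapeVal X : ℕ) : ℝ) * ((c₂ * shapeVal Y : ℕ) : ℝ) * ((c₃ * shapeVal Z : ℕ) : ℝ) *
        (((X i₀ : ℝ) * Y i₀ * Z i₀) ^ 2 * ((X i₁ : ℝ) * Y i₁ * Z i₁)) := by
  have hx := prod_pow_three_le X hX i₀ i₁ h0 h1
  have hy := prod_pow_three_le Y hY i₀ i₁ h0 h1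
  have hz := prod_pow_three_le Z hZ i₀ i₁ h0 h1
  have hx' : (∏ i, X i) ^ 3 ≤ c₁ * shapeVal X * (X i₀ ^ 2 * X i₁) :=
    hx.trans (Nat.mul_le_mul_right _ (Nat.le_mul_of_pos_left _ hc₁))
  have hy' : (∏ i, Y i) ^ 3 ≤ c₂ * shapeVal Y * (Y i₀ ^ 2 * Y i₁) :=
    hy.trans (Nat.mul_le_mul_right _ (Nat.le_mul_of_pos_left _ hc₂))
  have hz' : (∏ i, Z i) ^ 3 ≤ c₃ * shapeVal Z * (Z i₀ ^ 2 * Z i₁) :=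
    hz.trans (Nat.mul_le_mul_right _ (Nat.le_mul_of_pos_left _ hc₃))
  have hnat : ((∏ i, X i) * (∏ i, Y i) * (∏ i, Z i)) ^ 3 ≤
      (c₁ * shapeVal X) * (c₂ * shapeVal Y) * (c₃ * shapeVal Z) *
        ((X i₀ * Y i₀ * Z i₀) ^ 2 * (X i₁ * Y i₁ * Z i₁)) := by
    calc ((∏ i, X i) * (∏ i, Y i) * (∏ i, Z i)) ^ 3
        = (∏ i, X i) ^ 3 * (∏ i, Y i) ^ 3 * (∏ i, Z i) ^ 3 := by ring
      _ ≤ (c₁ * shapeVal X * (X i₀ ^ 2 * X i₁)) * (c₂ * shapeVal Y * (Y i₀ ^ 2 * Y i₁)) *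
            (c₃ * shapeVal Z * (Z i₀ ^ 2 * Z i₁)) :=
          Nat.mul_le_mul (Nat.mul_le_mul hx' hy') hz'
      _ = (c₁ * shapeVal X) * (c₂ * shapeVal Y) * (c₃ * shapeVal Z) *
            ((X i₀ * Y i₀ * Z i₀) ^ 2 * (X i₁ * Y i₁ * Z i₁)) := by ring
  have hR : (∏ i, ((X i : ℝ) * Y i * Z i)) =
      (((∏ i, X i) * (∏ i, Y i) * (∏ i, Z i) : ℕ) : ℝ) := by
    push_cast
    simp only [prod_mul_distrib]
  rw [hR]
  exact_mod_cast hnat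

/-- One shape tuple: `(∏ᵢ xᵢ)² ≤ (∏ᵢ xᵢ^{i+1}) · x₀`, because every exponent `i + 1` with `i ≥ 1` is `≥ 2`. [folklore] -/
theorem prod_sq_le {M : ℕ} (X : Fin M → ℕ) (hX : ∀ i, 0 < X i) (i₀ : Fin M) (h0 : (i₀ : ℕ) = 0) :
    (∏ i, X i) ^ 2 ≤ shapeVal X * X i₀ := by
  obtain ⟨m, rfl⟩ : ∃ m, M = m + 1 := ⟨M - 1, by have := i₀.isLt; omega⟩
  have hi0 : i₀ = 0 := Fin.ext h0
  rw [hi0, shapeVal, Fin.prod_univ_succ,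
    Fin.prod_univ_succ (f := fun i : Fin (m + 1) => X i ^ ((i : ℕ) + 1))]
  simp only [Fin.val_zero, Fin.val_succ, zero_add, pow_one]
  set T : ℕ := ∏ i : Fin m, X i.succ with hTdef
  set T' : ℕ := ∏ i : Fin m, X i.succ ^ ((i : ℕ) + 1 + 1) with hT'def
  have hT : T ^ 2 ≤ T' := by
    rw [hTdef, hT'def, ← prod_pow]
    refine prod_le_prod (fun i _ => Nat.zero_le _) fun i _ => ?_
    exact Nat.pow_le_pow_right (hX _) (by omega)
  calc (X 0 * T) ^ 2 = X 0 * X 0 * T ^ 2 := by ring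
    _ ≤ X 0 * X 0 * T' := Nat.mul_le_mul_left _ hT
    _ = X 0 * T' * X 0 := by ring

/-- THE SECOND STRUCTURE INEQUALITY `P² ≤ Θ³(2C₀)³·P₀`, in the form
`(∏ XᵢYᵢZᵢ)² ≤ (c₁·shapeVal X)(c₂·shapeVal Y)(c₃·shapeVal Z) · (X₀Y₀Z₀)`. [folklore] -/
theorem prod_sq_le_three {M : ℕ} {c₁ c₂ c₃ : ℕ} (hc₁ : 0 < c₁) (hc₂ : 0 < c₂) (hc₃ : 0 < c₃)
    (X Y Z : Fin M → ℕ) (hX : ∀ i, 0 < X i) (hY : ∀ i, 0 < Y i) (hZ : ∀ i, 0 < Z i)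
    (i₀ : Fin M) (h0 : (i₀ : ℕ) = 0) :
    (∏ i, ((X i : ℝ) * Y i * Z i)) ^ 2 ≤
      ((c₁ * shapeVal X : ℕ) : ℝ) * ((c₂ * shapeVal Y : ℕ) : ℝ) * ((c₃ * shapeVal Z : ℕ) : ℝ) *
        ((X i₀ : ℝ) * Y i₀ * Z i₀) := by
  have hx' : (∏ i, X i) ^ 2 ≤ c₁ * shapeVal X * X i₀ :=
    (prod_sq_le X hX i₀ h0).trans (Nat.mul_le_mul_right _ (Nat.le_mul_of_pos_left _ hc₁))
  have hy' : (∏ i, Y i) ^ 2 ≤ c₂ * shapeVal Y * Y i₀ :=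
    (prod_sq_le Y hY i₀ h0).trans (Nat.mul_le_mul_right _ (Nat.le_mul_of_pos_left _ hc₂))
  have hz' : (∏ i, Z i) ^ 2 ≤ c₃ * shapeVal Z * Z i₀ :=
    (prod_sq_le Z hZ i₀ h0).trans (Nat.mul_le_mul_right _ (Nat.le_mul_of_pos_left _ hc₃))
  have hnat : ((∏ i, X i) * (∏ i, Y i) * (∏ i, Z i)) ^ 2 ≤
      (c₁ * shapeVal X) * (c₂ * shapeVal Y) * (c₃ * shapeVal Z) * (X i₀ * Y i₀ * Z i₀) := by
    calc ((∏ i, X i) * (∏ i, Y i) * (∏ i, Z i)) ^ 2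
        = (∏ i, X i) ^ 2 * (∏ i, Y i) ^ 2 * (∏ i, Z i) ^ 2 := by ring
      _ ≤ (c₁ * shapeVal X * X i₀) * (c₂ * shapeVal Y * Y i₀) * (c₃ * shapeVal Z * Z i₀) :=
          Nat.mul_le_mul (Nat.mul_le_mul hx' hy') hz'
      _ = (c₁ * shapeVal X) * (c₂ * shapeVal Y) * (c₃ * shapeVal Z) * (X i₀ * Y i₀ * Z i₀) := by ring
  have hR : (∏ i, ((X i : ℝ) * Y i * Z i)) =
      (((∏ i, X i) * (∏ i, Y i) * (∏ i, Z i) : ℕ) : ℝ) := by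
    push_cast
    simp only [prod_mul_distrib]
  rw [hR]
  exact_mod_cast hnat

/-! ## The depth-parametric emptiness lemma -/

/-- THE DEEP REGION AT DEPTH `τ` IS EMPTY FOR `l ≥ 2 - τ/2`: on admissible data at exponent `l ∈ [2 - τ/2, 2)`,
not-off-wall forces linear depth `≤ C₀^τ`, i.e. `P ≤ 2R·C₀^τ·P₀`. Two cases of not-off-wall beyond `P > 2R·P₀`.
(A) `P > 2R·P₁`: with `P > 2R C₀^τ P₀` and `prod_cube_le`, `8R³C₀^{2τ}·P₀²P₁ < P³ ≤ (2C₀)³ P₀²P₁`, i.e.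
`C₀^{3(l-1+3ε)+2τ} < C₀³` — impossible once `3(l-1) + 2τ ≥ 3`, which `l ≥ 2 - τ/2` gives (`2τ ≥ 3τ/2`).
(B) `P³ > 64 R³·A`: with `prod_sq_le_three` (`A ≥ P²/P₀`) this gives `P·P₀ > 64R³`, and with
`P₀ < P/(2RC₀^τ)` and `P ≤ (2C₀)^{l+3ε}`: `128 R⁴ C₀^τ < 2^{2l+6ε} C₀^{2l+6ε} < 128 C₀^{2l+6ε}` — impossible once
`4(l-1) + τ ≥ 2l`, i.e. `l ≥ 2 - τ/2`. [folklore] -/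
theorem not_deep_of_depth : ∀ (l ε τ : ℝ), 0 ≤ ε → ε < 1 / 2 → 2 - τ / 2 ≤ l → l < 2 → ∀ (M C₀ c₁ c₂ c₃ : ℕ) (X Y Z : Fin M → ℕ), Literature.NumberTheory.DiophantineGeometry.AbcShapes.Admissible l ε C₀ c₁ c₂ c₃ X Y Z → ∀ (i₀ i₁ : Fin M), (i₀ : ℕ) = 0 → (i₁ : ℕ) = 1 → ¬ ((∏ i, ((X i : ℝ) * Y i * Z i)) ≤ 2 * (C₀ : ℝ) ^ (l - 1 + 3 * ε) * ((X i₀ : ℝ) * Y i₀ * Z i₀) ∨ ((∏ i, ((X i : ℝ) * Y i * Z i)) ≤ 2 * (C₀ : ℝ) ^ (l - 1 + 3 * ε) * ((X i₁ : ℝ) * Y i₁ * Z i₁) ∧ (∏ i, ((X i : ℝ) * Y i * Z i)) ^ 3 ≤ 64 * ((C₀ : ℝ) ^ (l - 1 + 3 * ε)) ^ 3 * (((c₁ * Literature.NumberTheory.DiophantineGeometry.AbcShapes.shapeVal X : ℕ) : ℝ) * ((c₂ * Literature.NumberTheory.DiophantineGeometry.AbcShapes.shapeVal Y : ℕ) :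 ℝ) * ((c₃ * Literature.NumberTheory.DiophantineGeometry.AbcShapes.shapeVal Z : ℕ) : ℝ)))) → (∏ i, ((X i : ℝ) * Y i * Z i)) ≤ 2 * (C₀ : ℝ) ^ (l - 1 + 3 * ε) * (C₀ : ℝ) ^ τ * ((X i₀ : ℝ) * Y i₀ * Z i₀) := by
  intro l ε τ hε hε2 hl hl2 M C₀ c₁ c₂ c₃ X Y Z hA i₀ i₁ h0 h1 hoff
  -- adapted from Cruxes/MazurKaneLaw/Lines/critical_kloosterman_powerful_moduli.lean (`not_deep`, τ = 1/4)
  by_contra hnw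
  push Not at hnw
  set P : ℝ := ∏ i, ((X i : ℝ) * Y i * Z i) with hP
  set P₀ : ℝ := (X i₀ : ℝ) * Y i₀ * Z i₀ with hP₀
  set P₁ : ℝ := (X i₁ : ℝ) * Y i₁ * Z i₁ with hP₁
  set A : ℝ := ((c₁ * shapeVal X : ℕ) : ℝ) * ((c₂ * shapeVal Y : ℕ) : ℝ) * ((c₃ * shapeVal Z : ℕ) : ℝ)
    with hAdef
  set R : ℝ := (C₀ : ℝ) ^ (l - 1 + 3 * ε) with hRdef
  set C4 : ℝ := (C₀ : ℝ) ^ τ with hC4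
  have hC₀ : (1 : ℝ) ≤ C₀ := by exact_mod_cast hA.one_le
  have hC₀pos : (0 : ℝ) < C₀ := by linarith
  have hRpos : 0 < R := Real.rpow_pos_of_pos hC₀pos _
  have hC4pos : 0 < C4 := Real.rpow_pos_of_pos hC₀pos _
  have hXpos : ∀ i, (0 : ℝ) < X i := fun i => by exact_mod_cast hA.X_pos i
  have hYpos : ∀ i, (0 : ℝ) < Y i := fun i => by exact_mod_cast hA.Y_pos i
  have hZpos : ∀ i, (0 : ℝ) < Z i := fun i => by exact_mod_cast hA.Z_pos i
  have hPpos : 0 < P := prod_pos fun i _ => mul_pos (mul_pos (hXpos i) (hYpos i)) (hZpos i)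
  have hP₀pos : 0 < P₀ := mul_pos (mul_pos (hXpos _) (hYpos _)) (hZpos _)
  have hP₁pos : 0 < P₁ := mul_pos (mul_pos (hXpos _) (hYpos _)) (hZpos _)
  -- `A ≤ (2C₀)³`
  have hAle : A ≤ (2 * (C₀ : ℝ)) ^ 3 := by
    have h₁ : ((c₁ * shapeVal X : ℕ) : ℝ) ≤ 2 * (C₀ : ℝ) := by exact_mod_cast hA.valX_le
    have h₂ : ((c₂ * shapeVal Y : ℕ) : ℝ) ≤ 2 * (C₀ : ℝ) := by exact_mod_cast hA.valY_le
    have h₃ : ((c₃ * shapeVal Z : ℕ) : ℝ) ≤ 2 * (C₀ : ℝ) := by exact_mod_cast hA.valZ_le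
    rw [hAdef]
    calc ((c₁ * shapeVal X : ℕ) : ℝ) * ((c₂ * shapeVal Y : ℕ) : ℝ) * ((c₃ * shapeVal Z : ℕ) : ℝ)
        ≤ (2 * (C₀ : ℝ)) * (2 * (C₀ : ℝ)) * (2 * (C₀ : ℝ)) := by
          gcongr
      _ = (2 * (C₀ : ℝ)) ^ 3 := by ring
  have hstruct : P ^ 3 ≤ A * (P₀ ^ 2 * P₁) :=
    prod_cube_le hA.pos₁ hA.pos₂ hA.pos₃ X Y Z hA.X_pos hA.Y_pos hA.Z_pos i₀ i₁ h0 h1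
  have hstruct2 : P ^ 2 ≤ A * P₀ :=
    prod_sq_le_three hA.pos₁ hA.pos₂ hA.pos₃ X Y Z hA.X_pos hA.Y_pos hA.Z_pos i₀ h0
  have hoff' : 2 * R * P₁ < P ∨ 64 * R ^ 3 * A < P ^ 3 := by
    by_contra h
    push Not at h
    exact hoff (Or.inr h)
  have hnw2 : (2 * R * C4 * P₀) ^ 2 < P ^ 2 :=
    pow_lt_pow_left₀ hnw (by positivity) two_ne_zero
  rcases hoff' with hcaseA | hcaseB
  · have hprod : (2 * R * C4 * P₀) ^ 2 * (2 * R * P₁) < P ^ 2 * P :=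
      mul_lt_mul'' hnw2 hcaseA (by positivity) (by positivity)
    have hkey : 8 * R ^ 3 * C4 ^ 2 * (P₀ ^ 2 * P₁) < (2 * (C₀ : ℝ)) ^ 3 * (P₀ ^ 2 * P₁) := by
      calc 8 * R ^ 3 * C4 ^ 2 * (P₀ ^ 2 * P₁) = (2 * R * C4 * P₀) ^ 2 * (2 * R * P₁) := by ring
        _ < P ^ 2 * P := hprod
        _ = P ^ 3 := by ring
        _ ≤ A * (P₀ ^ 2 * P₁) := hstruct
        _ ≤ (2 * (C₀ : ℝ)) ^ 3 * (P₀ ^ 2 * P₁) := mul_le_mul_of_nonneg_right hAle (by positivity)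
    have hkey' : 8 * R ^ 3 * C4 ^ 2 < (2 * (C₀ : ℝ)) ^ 3 :=
      lt_of_mul_lt_mul_right hkey (by positivity)
    -- exponent bookkeeping: `R³ C4² = C₀^{3(l-1+3ε)+2τ} ≥ C₀³`
    have hexp : R ^ 3 * C4 ^ 2 = (C₀ : ℝ) ^ (3 * (l - 1 + 3 * ε) + 2 * τ) := by
      rw [hRdef, hC4, ← Real.rpow_natCast ((C₀ : ℝ) ^ (l - 1 + 3 * ε)) 3,
        ← Real.rpow_natCast ((C₀ : ℝ) ^ τ) 2, ← Real.rpow_mul hC₀pos.le,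
        ← Real.rpow_mul hC₀pos.le, ← Real.rpow_add hC₀pos]
      congr 1
      push_cast
      ring
    have hge : (C₀ : ℝ) ^ (3 : ℝ) ≤ (C₀ : ℝ) ^ (3 * (l - 1 + 3 * ε) + 2 * τ) :=
      Real.rpow_le_rpow_of_exponent_le hC₀ (by nlinarith)
    have h3 : (C₀ : ℝ) ^ (3 : ℝ) = (C₀ : ℝ) ^ 3 := by exact_mod_cast Real.rpow_natCast (C₀ : ℝ) 3
    have hge' : (C₀ : ℝ) ^ 3 ≤ R ^ 3 * C4 ^ 2 := by
      rw [hexp, ← h3]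
      exact hge
    have h8 : (2 * (C₀ : ℝ)) ^ 3 = 8 * ((C₀ : ℝ) ^ 3) := by ring
    have h9 : 8 * ((C₀ : ℝ) ^ 3) ≤ 8 * (R ^ 3 * C4 ^ 2) :=
      mul_le_mul_of_nonneg_left hge' (by norm_num)
    have h10 : 8 * R ^ 3 * C4 ^ 2 = 8 * (R ^ 3 * C4 ^ 2) := by ring
    rw [h8, h10] at hkey'
    exact absurd (lt_of_lt_of_le hkey' h9) (lt_irrefl _)
  · have hB1 : 64 * R ^ 3 * P ^ 2 < P ^ 3 * P₀ := by
      calc 64 * R ^ 3 * P ^ 2 ≤ 64 * R ^ 3 * (A * P₀) := mul_le_mul_of_nonneg_left hstruct2 (by positivity)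
        _ = 64 * R ^ 3 * A * P₀ := by ring
        _ < P ^ 3 * P₀ := mul_lt_mul_of_pos_right hcaseB hP₀pos
    have hB2 : 64 * R ^ 3 < P * P₀ := by
      have h := lt_of_mul_lt_mul_right (show 64 * R ^ 3 * P ^ 2 < P * P₀ * P ^ 2 by nlinarith [hB1])
        (by positivity)
      exact h
    have hB3 : 64 * R ^ 3 * (2 * R * C4) < P * P := by
      calc 64 * R ^ 3 * (2 * R * C4) < P * P₀ * (2 * R * C4) := mul_lt_mul_of_pos_right hB2 (by positivity)
        _ = P * (2 * R * C4 * P₀) := by ring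
        _ ≤ P * P := mul_le_mul_of_nonneg_left hnw.le hPpos.le
    have hΛ : (0 : ℝ) ≤ 2 * (C₀ : ℝ) := by positivity
    have hPle : P ≤ (2 * (C₀ : ℝ)) ^ (l + 3 * ε) := hA.prod_le
    have hP2 : P * P ≤ (2 : ℝ) ^ (2 * (l + 3 * ε)) * (C₀ : ℝ) ^ (2 * (l + 3 * ε)) := by
      have h1 : P * P ≤ (2 * (C₀ : ℝ)) ^ (l + 3 * ε) * (2 * (C₀ : ℝ)) ^ (l + 3 * ε) :=
        mul_le_mul hPle hPle hPpos.le (Real.rpow_nonneg hΛ _)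
      have h2 : (2 * (C₀ : ℝ)) ^ (l + 3 * ε) * (2 * (C₀ : ℝ)) ^ (l + 3 * ε) =
          (2 : ℝ) ^ (2 * (l + 3 * ε)) * (C₀ : ℝ) ^ (2 * (l + 3 * ε)) := by
        rw [← Real.rpow_add (by positivity : (0 : ℝ) < 2 * (C₀ : ℝ)), Real.mul_rpow (by norm_num) hC₀pos.le]
        ring_nf
      rw [h2] at h1
      exact h1
    have h2lt : (2 : ℝ) ^ (2 * (l + 3 * ε)) < 128 := by
      have h7 : (2 : ℝ) ^ (2 * (l + 3 * ε)) < (2 : ℝ) ^ (7 : ℝ) :=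
        Real.rpow_lt_rpow_of_exponent_lt (by norm_num) (by linarith)
      have h7' : (2 : ℝ) ^ (7 : ℝ) = 128 := by
        rw [show (7 : ℝ) = ((7 : ℕ) : ℝ) by norm_num, Real.rpow_natCast]
        norm_num
      linarith
    have hCexp : (C₀ : ℝ) ^ (2 * (l + 3 * ε)) ≤ (C₀ : ℝ) ^ (4 * (l - 1 + 3 * ε) + τ) :=
      Real.rpow_le_rpow_of_exponent_le hC₀ (by linarith)
    have hexp4 : R ^ 3 * (R * C4) = (C₀ : ℝ) ^ (4 * (l - 1 + 3 * ε) + τ) := by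
      rw [hRdef, hC4, ← Real.rpow_natCast ((C₀ : ℝ) ^ (l - 1 + 3 * ε)) 3, ← Real.rpow_mul hC₀pos.le,
        ← Real.rpow_add hC₀pos, ← Real.rpow_add hC₀pos]
      congr 1
      push_cast
      ring
    have hCpos2 : (0 : ℝ) < (C₀ : ℝ) ^ (2 * (l + 3 * ε)) := Real.rpow_pos_of_pos hC₀pos _
    have hchain : 128 * (C₀ : ℝ) ^ (4 * (l - 1 + 3 * ε) + τ) < 128 * (C₀ : ℝ) ^ (4 * (l - 1 + 3 * ε) + τ) := by
      calc 128 * (C₀ : ℝ) ^ (4 * (l - 1 + 3 * ε) + τ) = 64 * R ^ 3 * (2 * R * C4) := by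
            rw [← hexp4]; ring
        _ < P * P := hB3
        _ ≤ (2 : ℝ) ^ (2 * (l + 3 * ε)) * (C₀ : ℝ) ^ (2 * (l + 3 * ε)) := hP2
        _ ≤ 128 * (C₀ : ℝ) ^ (2 * (l + 3 * ε)) := mul_le_mul_of_nonneg_right h2lt.le hCpos2.le
        _ ≤ 128 * (C₀ : ℝ) ^ (4 * (l - 1 + 3 * ε) + τ) := mul_le_mul_of_nonneg_left hCexp (by norm_num)
    exact lt_irrefl _ hchain

end Summit.ABC.ABC.Theorems.MazurKaneLaw

end
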